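import Summits.RiemannHypothesis.RiemannHypothesis.Theorems.LagariasZeroFreeDoor
import HarnessLib

/-!
# Phragmén–Lindelöf on an ARBITRARY SUBSET of a horizontal strip with growth assumed only on a cofinal family of circles
# (Lagarias zero-free door, part 1/2: the analytic lemma; RH-free, Mathlib-only content)

Cell rh-split, seat rh-split-dbr-neg g6 (brief sha16 f79c5f09d8bcb036), card `run/shared/lean/pub/rh-split/cards/SPLIT-dbr-neg.md` §14;
carve of `HOME/rh-split-dbr-neg/SketchG6.lean` (sha16 081103008145d3f5, ns `…Scratch.SplitDbrNegG6`) filed by rh-split-typer-1 g4 in two parts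
(400-line rule): `LagariasZeroFreeDoorStripPL` (Part A, pure complex analysis) and `LagariasZeroFreeDoorStrip` (Part B).  Proofs verbatim.

Part A — `norm_le_of_subset_strip`: Phragmén–Lindelöf on an arbitrary subset `U` of a horizontal strip `{a < Im z < b}`, the a-priori
growth `‖f‖ ≤ exp (B e^{c‖z‖})`, `c < π/(b−a)`, being assumed ONLY at the points of `U` on a cofinal family of circles `‖z‖ = R` (Mathlib's
damping factor + bounded maximum modulus on `U ∩ ball 0 R`); `horizontal_strip_of_sphereGrowth` is the whole-strip corollary.  (Mathlib's
`PhragmenLindelof.horizontal_strip` needs the growth everywhere along `|Re z| → ∞` on the full strip; no component structure of `U` is used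
here, which is what makes hypothesis (B2) of the card's §13.3 unnecessary.)  References: Mathlib `PhragmenLindelof.horizontal_strip`;
E. C. Titchmarsh, *The Theory of Functions* §5.6.
Nothing here is a claim about the truth of RH; the door `RH ⟺ E_ξ zero-free on ℂ₊` stays RH-EQUIVALENT (and conditional on the textbook input `MinModulusCircles`).
-/

noncomputable section

-- D-0017: `Summit.<S>.<S>.…` is the designed namespace of a single-problem summit.
set_option linter.dupNamespace false

open Set Filter Metric Complex Bornology Topology
open scoped ComplexConjugate
open Literature.NumberTheory.LFunctions Literature.Analysis.DeBrangesSpaces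
open Summit.RiemannHypothesis.RiemannHypothesis.Theorems.LagariasZeroFreeDoor

namespace Summit.RiemannHypothesis.RiemannHypothesis.Theorems.LagariasZeroFreeDoorStrip

/-! ## Part A — Phragmén–Lindelöf on a subset of a strip, growth on circles (Mathlib only) -/

section PartA

variable {F : Type*} [NormedAddCommGroup F] [NormedSpace ℂ F]

/-- **Phragmén–Lindelöf on an open subset of a horizontal strip, growth on circles** (core case `0 < C`,
interior point).  `U ⊆ {a < Im z < b}`, `f` holomorphic on `U` and continuous on `closure U`,
`‖f‖ ≤ C` on `frontier U`, and the circle growth; then `‖f z‖ ≤ C` on `U`.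
Proof: Mathlib's damping factor `exp (ε (e^{d(z − i m)} + e^{−d(z − i m)}))`, `ε < 0`, `c < d < π/(b−a)`,
and the bounded maximum-modulus principle on `U ∩ ball 0 R` for a good radius `R`. -/
theorem norm_le_of_subset_strip_aux {f : ℂ → F} {U : Set ℂ} {a b C : ℝ} (hab : a < b)
    (hU : U ⊆ im ⁻¹' Ioo a b) (hd : DiffContOnCl ℂ f U) (hC₀ : 0 < C)
    (hfr : ∀ z ∈ frontier U, ‖f z‖ ≤ C)
    (hgr : ∃ c < Real.pi / (b - a), ∃ B : ℝ, ∀ R₀ : ℝ, ∃ R : ℝ, R₀ ≤ R ∧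
      ∀ z ∈ U, ‖z‖ = R → ‖f z‖ ≤ Real.exp (B * Real.exp (c * R)))
    {z : ℂ} (hz : z ∈ U) : ‖f z‖ ≤ C := by
  obtain ⟨m, w, rfl, rfl⟩ : ∃ m w : ℝ, a = m - w ∧ b = m + w :=
    ⟨(a + b) / 2, (b - a) / 2, by ring, by ring⟩
  have hw : 0 < w := by linarith
  have hmw : m - w < m + w := hab
  rw [show m + w - (m - w) = 2 * w by ring, div_mul_eq_div_div] at hgr
  have hπw : 0 < Real.pi / 2 / w := div_pos Real.pi_div_two_pos hw
  rcases hgr with ⟨c, hc, B, hR⟩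
  obtain ⟨d, ⟨hcd, hd₀⟩, hdlt⟩ : ∃ d, (c < d ∧ 0 < d) ∧ d < Real.pi / 2 / w := by
    simpa only [max_lt_iff] using exists_between (max_lt hc hπw)
  have hdw : d * w < Real.pi / 2 := (lt_div_iff₀ hw).1 hdlt
  set aff := (fun ζ => d * (ζ - m * I) : ℂ → ℂ)
  set g := fun (ε : ℝ) (ζ : ℂ) => exp (ε * (exp (aff ζ) + exp (-aff ζ)))
  set M : ℝ := max |m - w| |m + w| with hM
  -- Step 1: it suffices to bound the damped function for every `ε < 0`.
  suffices h : ∀ᶠ ε : ℝ in 𝓝[<] (0 : ℝ), ‖g ε z • f z‖ ≤ C by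
    refine le_of_tendsto (Tendsto.mono_left ?_ nhdsWithin_le_nhds) h
    apply ((continuous_ofReal.mul continuous_const).cexp.smul continuous_const).norm.tendsto'
    simp
  filter_upwards [self_mem_nhdsWithin] with ε ε₀; change ε < 0 at ε₀
  -- Step 2: the norm estimate for the damping factor on the closed strip.
  obtain ⟨δ, δ₀, hδ⟩ : ∃ δ : ℝ, δ < 0 ∧
      ∀ ⦃ζ : ℂ⦄, ζ.im ∈ Icc (m - w) (m + w) → ‖g ε ζ‖ ≤ Real.exp (δ * Real.exp (d * |ζ.re|)) := by
    refine
      ⟨ε * Real.cos (d * w),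
        mul_neg_of_neg_of_pos ε₀
          (Real.cos_pos_of_mem_Ioo <| abs_lt.1 <| (abs_of_pos (mul_pos hd₀ hw)).symm ▸ hdw),
        fun ζ hζ => ?_⟩
    replace hζ : |im (aff ζ)| ≤ d * w := by
      rw [← Real.closedBall_eq_Icc, mem_closedBall, Real.dist_eq] at hζ
      rw [im_ofReal_mul, sub_im, mul_I_im, ofReal_re, _root_.abs_mul, abs_of_pos hd₀]
      gcongr
    simpa only [aff, re_ofReal_mul, _root_.abs_mul, abs_of_pos hd₀, sub_re, mul_I_re, ofReal_im,
      zero_mul, neg_zero, sub_zero] using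
      norm_exp_mul_exp_add_exp_neg_le_of_abs_im_le ε₀.le hζ hdw.le
  have hg₁ : ∀ ζ : ℂ, ζ.im ∈ Icc (m - w) (m + w) → ‖g ε ζ‖ ≤ 1 := fun ζ hζ =>
    (hδ hζ).trans (Real.exp_le_one_iff.2 (mul_nonpos_of_nonpos_of_nonneg δ₀.le (Real.exp_pos _).le))
  -- Step 3: along the good circles the damped function is eventually `≤ C`.
  set δ' : ℝ := δ * Real.exp (-(d * M)) with hδ'
  have hδ'₀ : δ' < 0 := mul_neg_of_neg_of_pos δ₀ (Real.exp_pos _)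
  have htend : Tendsto (fun R : ℝ => Real.exp (δ' * Real.exp (d * R) + B * Real.exp (c * R)))
      atTop (𝓝 0) := by
    refine Real.tendsto_exp_atBot.comp ?_
    suffices H : Tendsto (fun R => δ' + B * (Real.exp ((d - c) * R))⁻¹) atTop (𝓝 (δ' + B * 0)) by
      rw [mul_zero, add_zero] at H
      simpa only [id, (· ∘ ·), add_mul, mul_assoc, ← div_eq_inv_mul, ← Real.exp_sub, ← sub_mul,
        sub_sub_cancel]
        using H.neg_mul_atTop hδ'₀ <| Real.tendsto_exp_atTop.comp <| tendsto_id.const_mul_atTop hd₀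
    refine tendsto_const_nhds.add (tendsto_const_nhds.mul ?_)
    exact tendsto_inv_atTop_zero.comp <| Real.tendsto_exp_atTop.comp <|
      tendsto_id.const_mul_atTop (sub_pos.2 hcd)
  obtain ⟨R₁, hR₁⟩ : ∃ R₁ : ℝ, ∀ R ≥ R₁,
      Real.exp (δ' * Real.exp (d * R) + B * Real.exp (c * R)) ≤ C :=
    eventually_atTop.1 (htend.eventually (ge_mem_nhds hC₀))
  obtain ⟨R, hR₀R, hRgr⟩ := hR (max R₁ (‖z‖ + 1))
  have hzR : ‖z‖ < R := by linarith [le_max_right R₁ (‖z‖ + 1)]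
  have hR₁R : R₁ ≤ R := (le_max_left _ _).trans hR₀R
  have hRpos : 0 < R := (norm_nonneg z).trans_lt hzR
  -- Step 4: bounded maximum modulus on `U ∩ ball 0 R`.
  have hgd : Differentiable ℂ (g ε) :=
    ((((differentiable_id.sub_const _).const_mul _).cexp.add
      ((differentiable_id.sub_const _).const_mul _).neg.cexp).const_mul _).cexp
  have hdV : DiffContOnCl ℂ (fun ζ => g ε ζ • f ζ) (U ∩ ball (0 : ℂ) R) :=
    (hgd.diffContOnCl.smul hd).mono inter_subset_left
  have hclU : closure U ⊆ im ⁻¹' Icc (m - w) (m + w) := by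
    have h1 : closure U ⊆ closure (im ⁻¹' Ioo (m - w) (m + w)) := closure_mono hU
    rwa [closure_preimage_im, closure_Ioo hmw.ne] at h1
  have key : ∀ ζ ∈ frontier (U ∩ ball (0 : ℂ) R), ‖g ε ζ • f ζ‖ ≤ C := by
    intro ζ hζ
    by_cases hfrU : ζ ∈ frontier U
    · have him : ζ.im ∈ Icc (m - w) (m + w) := hclU (frontier_subset_closure hfrU)
      rw [norm_smul, ← one_mul C]
      exact mul_le_mul (hg₁ ζ him) (hfr ζ hfrU) (norm_nonneg _) zero_le_one
    · have h2 : ζ ∈ closure U ∩ frontier (ball (0 : ℂ) R) := by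
        rcases frontier_inter_subset U (ball (0 : ℂ) R) hζ with h | h
        · exact absurd h.1 hfrU
        · exact h
      have hζU : ζ ∈ U := by
        have h3 := h2.1
        rw [closure_eq_self_union_frontier] at h3
        exact h3.resolve_right hfrU
      have hnorm : ‖ζ‖ = R := by
        have h3 := h2.2
        rw [frontier_ball (0 : ℂ) hRpos.ne'] at h3
        simpa using h3
      have him : ζ.im ∈ Ioo (m - w) (m + w) := hU hζU
      have hre : R - M ≤ |ζ.re| := by
        have h4 : ‖ζ‖ ≤ |ζ.re| + |ζ.im| := norm_le_abs_re_add_abs_im ζ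
        have h5 : |ζ.im| ≤ M := abs_le_max_abs_abs him.1.le him.2.le
        linarith
      have hgζ : ‖g ε ζ‖ ≤ Real.exp (δ' * Real.exp (d * R)) := by
        refine (hδ (Ioo_subset_Icc_self him)).trans ?_
        rw [Real.exp_le_exp, hδ', mul_assoc, ← Real.exp_add]
        refine mul_le_mul_of_nonpos_left ?_ δ₀.le
        rw [Real.exp_le_exp]
        nlinarith
      calc ‖g ε ζ • f ζ‖ = ‖g ε ζ‖ * ‖f ζ‖ := norm_smul _ _
        _ ≤ Real.exp (δ' * Real.exp (d * R)) * Real.exp (B * Real.exp (c * R)) :=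
          mul_le_mul hgζ (hRgr ζ hζU hnorm) (norm_nonneg _) (Real.exp_pos _).le
        _ = Real.exp (δ' * Real.exp (d * R) + B * Real.exp (c * R)) := (Real.exp_add _ _).symm
        _ ≤ C := hR₁ R hR₁R
  have hzcl : z ∈ closure (U ∩ ball (0 : ℂ) R) := subset_closure ⟨hz, mem_ball_zero_iff.2 hzR⟩
  exact norm_le_of_forall_mem_frontier_norm_le (isBounded_ball.subset inter_subset_right) hdV key hzcl

/-- A nonempty open subset of a horizontal strip has nonempty frontier (`ℂ` is connected). -/
theorem frontier_nonempty_of_subset_strip {U : Set ℂ} {a b : ℝ}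
    (hU : U ⊆ im ⁻¹' Ioo a b) (hne : U.Nonempty) : (frontier U).Nonempty := by
  by_contra h
  rw [Set.not_nonempty_iff_eq_empty, ← isClopen_iff_frontier_eq_empty, isClopen_iff] at h
  rcases h with h | h
  · exact hne.ne_empty h
  · have hb : ((b : ℂ) * I) ∈ U := by rw [h]; exact mem_univ _
    have := hU hb
    simp at this

/-- **Phragmén–Lindelöf on an open subset of a horizontal strip, growth on circles.**  For `U ⊆ {a < Im z < b}`
open, `f` holomorphic on `U`, continuous on `closure U`, `‖f‖ ≤ C` on `frontier U`, and the growth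
`‖f z‖ ≤ exp (B exp (c‖z‖))` (`c < π/(b−a)`) assumed only at the points of `U` on a cofinal family of circles
`‖z‖ = R`, one has `‖f z‖ ≤ C` on `closure U`.  (Mathlib's `PhragmenLindelof.horizontal_strip` is the case
`U` = the whole strip with growth everywhere.) -/
theorem norm_le_of_subset_strip {f : ℂ → F} {U : Set ℂ} {a b C : ℝ} (hab : a < b)
    (hU : U ⊆ im ⁻¹' Ioo a b) (hd : DiffContOnCl ℂ f U)
    (hfr : ∀ z ∈ frontier U, ‖f z‖ ≤ C)
    (hgr : ∃ c < Real.pi / (b - a), ∃ B : ℝ, ∀ R₀ : ℝ, ∃ R : ℝ, R₀ ≤ R ∧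
      ∀ z ∈ U, ‖z‖ = R → ‖f z‖ ≤ Real.exp (B * Real.exp (c * R)))
    {z : ℂ} (hz : z ∈ closure U) : ‖f z‖ ≤ C := by
  rw [closure_eq_self_union_frontier] at hz
  rcases hz with hz | hz
  swap
  · exact hfr z hz
  obtain ⟨ζ, hζ⟩ := frontier_nonempty_of_subset_strip hU ⟨z, hz⟩
  have hC : 0 ≤ C := (norm_nonneg _).trans (hfr ζ hζ)
  refine le_of_forall_gt_imp_ge_of_dense fun C' hC' => ?_
  exact norm_le_of_subset_strip_aux hab hU hd (hC.trans_lt hC') (fun w hw => (hfr w hw).trans hC'.le)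
    hgr hz

/-- The whole-strip corollary: **Phragmén–Lindelöf in `{a < Im z < b}` with the growth assumed only on a
cofinal family of circles** (instead of Mathlib's `IsBigO` along `|Re z| → ∞`). -/
theorem horizontal_strip_of_sphereGrowth {f : ℂ → F} {a b C : ℝ} (hab : a < b)
    (hd : DiffContOnCl ℂ f (im ⁻¹' Ioo a b))
    (hle_a : ∀ z : ℂ, z.im = a → ‖f z‖ ≤ C) (hle_b : ∀ z : ℂ, z.im = b → ‖f z‖ ≤ C)
    (hgr : ∃ c < Real.pi / (b - a), ∃ B : ℝ, ∀ R₀ : ℝ, ∃ R : ℝ, R₀ ≤ R ∧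
      ∀ z : ℂ, a < z.im → z.im < b → ‖z‖ = R → ‖f z‖ ≤ Real.exp (B * Real.exp (c * R)))
    {z : ℂ} (hza : a ≤ z.im) (hzb : z.im ≤ b) : ‖f z‖ ≤ C := by
  refine norm_le_of_subset_strip hab subset_rfl hd ?_ ?_ ?_
  · intro w hw
    rw [frontier_preimage_im, frontier_Ioo hab] at hw
    simp only [mem_preimage, mem_insert_iff, mem_singleton_iff] at hw
    rcases hw with hw | hw
    · exact hle_a w hw
    · exact hle_b w hw
  · obtain ⟨c, hc, B, h⟩ := hgr
    exact ⟨c, hc, B, fun R₀ => (h R₀).imp fun R hR => ⟨hR.1, fun w hw hwR => hR.2 w hw.1 hw.2 hwR⟩⟩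
  · rw [closure_preimage_im, closure_Ioo hab.ne]
    exact ⟨hza, hzb⟩

end PartA

end Summit.RiemannHypothesis.RiemannHypothesis.Theorems.LagariasZeroFreeDoorStrip

end
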